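import Mathlib
import HarnessLib
import HarnessLib.Audit
import Summits.HodgeConjecture.Statement
import Literature.AlgebraicGeometry.HodgeTheory.HodgeConjecture
import HarnessLib.Audit.Status.Attr

/-!
Route: EisensteinMiddleThird

DORMANT since 2026-08-24T22:01:04Z (reconciler: no traction for 7.1 d (last activity item-proof-filed at 2026-08-17T18:52:06Z); parked, not closed — `ledger route dormant route-HodgeConjecture-EisensteinMiddleThird --off` to reactivate) — unstaffed, not closed; items shared with open routes are served there. `ledger route dormant <id> --off` reactivates.

# Route EisensteinMiddleThird — cubic surfaces audit the middle third — HC on the Eisenstein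
Picard-modular 4-ball tower by a certified special/exotic-cycle census, level 3 first

DECLARED SECTOR ROUTE, realising idea card act-eisenstein-ball-census (spine). Sector = smooth
projective complex fourfolds X
containing a dense Zariski-open U = X ∖ Z whose analytification is Γ'\𝔹⁴ for a CONGRUENCE subgroup
Γ(N) ⊆ Γ' ⊆ Aut(Λ) of the
unitary group of the self-dual Eisenstein lattice Λ = 𝓔^{1,4}, 𝓔 = ℤ[ω] (Allcock–Carlson–Toledo:
Aut(Λ)\𝔹⁴ = moduli of cubic
surfaces; typed inline, conventions of AllcockFreitag2002 (2.1)/(3.1): J = diag(1,−1,−1,−1,−1), 𝔹⁴ =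
{|z₁|²+…+|z₄|² < 1} in the
chart z₀ = 1, deck relation w = γ·z written division-free) — i.e. every smooth birational model of a
compactified congruence cover
of the moduli space of cubic surfaces; frame to the summit = the explicitly NOT-claimed residual
SectorComplement (auto-crux-badged 2026-08-16; as in
SiuRepresentability / DerivedTorelliFermat). It suffices to show X = TowerMiddleAlgebraic: on every
such X every RATIONAL
(2,2)-class is algebraic — degree 4 on a 4-ball quotient is exactly the Bergeron–Millson–Moeglin
middle third ]4/3, 8/3[
(arXiv:1306.1515 Cor. 2, and there only for COMPACT quotients), the one degree no theorem covers;
Lefschetz (1,1) and hard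
Lefschetz — both PROVED in the tree (`Theorems.lefschetzOneOne_proof`,
`Theorems.linearSystemTorelli_hardLefschetzReduction_proof`) —
give the other degrees inside the provable-now support SectorFrame : TowerMiddleAlgebraic →
EisensteinTowerHodge (machine-checked
proof attached on stmt-HodgeConjecture-16813). The card's census enters as the
rank-2 crux LevelThreeMiddleAlgebraic (Γ' = Γ(3), the first torsion-free principal level: the census
VERDICT), the informal crux
LevelThreeSpecialExoticSpan filed right after open (Hdg⁴ of the toroidal compactification X̄₃ is
spanned by boundary,
divisor-product, special sub-ball and EXOTIC moduli cycles — the census METHOD, card K1–K3), and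
LevelThreeCanonicalForms
(p_g(X̄₃) = dim S₅(Γ(3)) > 0: level 3 is an honest test, not a Bloch–Srinivas/Conte–Murre vacuity).
Lean: `∀ ⦃X : Literature.AlgebraicGeometry.Motives.SchemeOver ℂ⦄,
Literature.AlgebraicGeometry.Motives.IsSmoothProjective 4 X → (∃ (A :
Literature.AlgebraicGeometry.HodgeTheory.HodgeModel 4 X) (Z : Set X.left) (S : Set (Matrix (Fin 5)
(Fin 5) ℂ)) (N : ℕ) (π : EuclideanSpace ℂ (Fin 4) → A.carrier), IsClosed Z ∧ 0 < N ∧ (∀ γ ∈ S, (∀ i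
j, ∃ a b : ℤ, γ i j = (a : ℂ) + (b : ℂ) * ((-1 + Complex.I * (Real.sqrt 3 : ℂ)) / 2)) ∧ γᴴ *
Matrix.diagonal ![(1 : ℂ), -1, -1, -1, -1] * γ = Matrix.diagonal ![(1 : ℂ), -1, -1, -1, -1]) ∧ (∀ γ
: Matrix (Fin 5) (Fin 5) ℂ, (∀ i j, ∃ a b : ℤ, γ i j - (1 : Matrix (Fin 5) (Fin 5) ℂ) i j = (N : ℂ)
* ((a : ℂ) + (b : ℂ) * ((-1 + Complex.I * (Real.sqrt 3 : ℂ)) / 2))) → γᴴ * Matrix.diagonal ![(1 :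
ℂ), -1, -1, -1, -1] * γ = Matrix.diagonal ![(1 : ℂ), -1, -1, -1, -1] → γ ∈ S) ∧ (∀ z ∈ Metric.ball
(0 : EuclideanSpace ℂ (Fin 4)) 1, MDifferentiableAt 𝓘(ℂ, EuclideanSpace ℂ (Fin 4)) 𝓘(ℂ, A.model) π
z) ∧ (∃ h : Set.MapsTo π (Metric.ball (0 : EuclideanSpace ℂ (Fin 4)) 1) {x : A.carrier |
(A.toComplexPoints x).pt ∉ Z}, IsCoveringMap h.restrict ∧ Function.Surjective h.restrict) ∧ (∀ z ∈
Metric.ball (0 : EuclideanSpace ℂ (Fin 4)) 1, ∀ w ∈ Metric.ball (0 : EuclideanSpace ℂ (Fin 4)) 1, π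
z = π w ↔ ∃ γ ∈ S, ∀ i : Fin 4, EuclideanSpace.equiv (Fin 4) ℂ w i * (γ 0 0 + ∑ j : Fin 4, γ 0
(Fin.succ j) * EuclideanSpace.equiv (Fin 4) ℂ z j) = γ (Fin.succ i) 0 + ∑ j : Fin 4, γ (Fin.succ i)
(Fin.succ j) * EuclideanSpace.equiv (Fin 4) ℂ z j)) → ∀ c :
Literature.AlgebraicGeometry.HodgeTheory.complexBetti X (2 * 2),
Literature.AlgebraicGeometry.HodgeTheory.IsRationalClass c →
Literature.AlgebraicGeometry.HodgeTheory.IsOfHodgeType 4 X (2 * 2) 2 2 c → c ∈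
Literature.AlgebraicGeometry.HodgeTheory.algebraicClasses X 2`

## Assembly
Crux-only deciding theorem (D-0027 §2.1, glue.crux_only 2026-08-16): `closes (hT :
EisensteinTowerHodge) (hC : SectorComplement) :
HodgeConjecture := hC hT` — the sector thesis EisensteinTowerHodge (HC in all degrees on the
Eisenstein Picard-modular sector; crux since
the cone route-repair, formerly the rank-0 target) and the declared residual SectorComplement are
its only hypotheses. The Assembly ITEM
is the D-0019 frame for X = TowerMiddleAlgebraic: `TowerMiddleAlgebraic → SectorComplement →
HodgeConjecture`, provable now as
`fun hM hC ↦ hC (sectorFrame_proof hM)`; SectorFrame : TowerMiddleAlgebraic → EisensteinTowerHodge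
(support, provable now; Sketch.lean
`sectorFrame_of` / prover-ready Theorems candidate attached on stmt-HodgeConjecture-16813, lean
check rc 0) is the case split on the
codimension p — 0 by algebraicClasses_zero, 1 by the PROVED Lefschetz (1,1), 2 by the crux, ≥ 3 by
the PROVED hard-Lefschetz reduction
down to codimension 4 − p ∈ {1, 0}; so EisensteinTowerHodge closes by the one-liner
`sectorFrame_proof towerMiddleAlgebraic_proof` once
the rank-3 crux is proved — provers attack LevelThreeMiddleAlgebraic / TowerMiddleAlgebraic /
SectorFrame, not the sector thesis
directly. CONE ROUTE-REPAIR 2026-08-16: the shared proved items LefschetzOneOne (stmt-8544) /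
HardLefschetzReduction (stmt-1084) and the
old glue SectorGlue (stmt-14413) were DROPPED from this route (they stay proved in the tree and
wanted by their home routes) because their
`_holds` links auto-imported Theorems/CurveNetMordellWeilLefschetzOneOneClose and
Theorems/LinearSystemTorelliHardLefschetzReduction,
whose import closure is ≈ 1 150 Literature modules declaring 122 unproved named facts that no item
of this route uses; SectorFrame is
not a `closes` hypothesis for the same reason (discharging it inside the proof would re-import that
cone), and its prover imports those
two Theorems files in a Theorems file that imports this Theses file, so the gate adds no back-import
and the route cone stays the
33-module Statement cone. LevelThreeMiddleAlgebraic is the Γ' = Γ(3) instance of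
TowerMiddleAlgebraic (opening planner's Sketch.lean
`levelThree_of_tower`, proved) and LevelThreeCanonicalForms its honesty certificate; neither is a
hypothesis of `closes`.

Rationale: WHY THIS LINE. Mechanism (imported areas: automorphic forms on unitary groups, moduli of del Pezzo
surfaces, certified computation): the ONE
U(4,1)-quotient that is explicitly computable is also a moduli space — AllcockCarlsonToledo2002
(moduli of cubic surfaces =
Aut(Λ)\𝔹⁴, marked cubics = Γ(√−3)\𝔹⁴, nodal cubics = short-root mirrors, Eckardt cubics = long-root
mirrors),
DolgachevGeemenKondo2005 (the same ball via K3 periods, so the variation of Hodge structure is of K3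
type and special cycles are
Noether–Lefschetz loci), Naruki1982 / ColomboVangeemen2004 / GallardoKerrSchaffler2021 (the toroidal
compactification at level
√−3 is Naruki's cross-ratio variety, a modification of ℙ⁴ with known Chow ring: every class
algebraic there), AllcockFreitag2002 /
Freitag2002 (the ring of modular forms for Γ(√−3); READ this session: Aut(Λ)/Γ(√−3) ≅ O(5,3) ≅
W(E₆)×{±1}, triflections lie in
Γ(√−3), 40 cusps, 36 + 45 mirror orbits, Prop. 2.1). Hence X̄₃ → Naruki is an elementary-abelian
(ℤ/3)^14-cover branched (to order 3)
only along the 36 nodal and the 40 boundary divisors, so (h^{4,0}, h^{3,1}, h^{2,2}) and rk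
Hdg⁴(X̄₃) are a Chevalley–Weil / equivariant
Riemann–Roch computation, while the algebraic side has three supplies with computable classes:
boundary (CM abelian threefolds
isogenous to E_ω³), special cycles (sub-balls of ℚ(ω)-sublattices; Kudla–Millson generating series
KudlaMillson1990, Cogdell's
Picard-surface precedent), and EXOTIC non-geodesic surfaces pushed down from moduli correspondences
(blowing down a line on
degree-2 del Pezzo surfaces — Kondō's Eisenstein 6-ball — and Deligne–Mostow forgetful maps,
Deraux2010), spread by Hecke
correspondences (one exotic cycle with non-zero projection to an irreducible Hecke-isotypic piece
makes the piece algebraic). What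
it does that prior routes do not: EndoscopicBallQuotient (closed not-a-thesis) treated COMPACT
simple-type quotients (F ≠ ℚ) by
endoscopy and predicted non-geodesic classes without a supply; SiuRepresentability's family is
COMPACT quotients (Siu needs a
compact target; its header defers finite-volume quotients); BMM (arXiv:1306.1515, READ pp.1–3:
anisotropic forms only, and Remark 3:
special cycles alone do not span even in codimension one) excludes degree 4 on 4-balls; this route
is the NON-compact Picard-modular
sector over ℚ(ω), where the moduli interpretation supplies candidate cycles and the first open case
is a finite computation. No
probabilistic / PDE reformulation applies; the spectral side (Matsushima, Arthur–Mok packets for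
U(4,1): θ-type Π₄⊞χ, endoscopic
Π₃⊞Π₂, stable) is used only to ORGANISE which Hecke pieces can carry rational (2,2)-classes, never
assumed.

RANKED CRUXES. #0 EisensteinTowerHodge (crux; was the target — re-kinded 2026-08-16 because it is a
hypothesis of the crux-only `closes`; closes mechanically from TowerMiddleAlgebraic + SectorFrame,
attack those) — the Hodge conjecture (Literature HodgeConjectureFor 4 X, all codimensions) for every
smooth projective complex fourfold X with a Zariski-closed Z ⊆ X such that (X ∖ Z)^an is uniformised
by 𝔹⁴ with deck relation generated by a set S of Λ-unitary Eisenstein-integral matrices containing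
the principal congruence subgroup Γ(N) for some N ≥ 1 (typed inline: a Hodge model A, π : ℂ⁴ →
A.carrier holomorphic on the ball, a surjective covering map of the ball onto {x :
(A.toComplexPoints x).pt ∉ Z}, and π z = π w ↔ ∃ γ ∈ S, w = γ·z division-free in the chart z₀ = 1).
(why it might fail: it is HC for (all birational models of) the Eisenstein Picard-modular fourfolds:
open in degree 4 = BMM's excluded middle for p = 4 even in the compact case (arXiv:1306.1515 Cor.
2); false iff some congruence cover carries a non-algebraic rational (2,2)-class.)
[AllcockCarlsonToledo2002, arXiv:1306.1515, BergeronMillsonMoeglin2016Balls, Deligne2000]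
#2 LevelThreeMiddleAlgebraic (crux) — (card verdict (iv), level Γ(3)) for every smooth projective
fourfold X with Zariski-closed Z such that (X ∖ Z)^an ≅ Γ(3)\𝔹⁴, Γ(3) = {γ ∈ M₅(𝓔) : γᴴJγ = J, γ ≡ 1
mod 3} the (torsion-free, neat) principal congruence subgroup of level 3 of Aut(𝓔^{1,4}) — e.g. the
smooth toroidal compactification X̄₃, an elementary-abelian 3-cover of Naruki's cross-ratio variety
branched only along the 36 nodal and 40 boundary divisors — every rational (2,2)-class in H⁴(X(ℂ);ℂ)
lies in algebraicClasses X 2. This is the census TARGET; its method is the informal crux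
LevelThreeSpecialExoticSpan (rank 5, filed after open). [difficulty: XL] (why it might fail: a
rational (2,2)-class in a Hecke piece of H⁴(X̄₃) of endoscopic type Π₃⊞Π₂ or θ-deficient type Π₄⊞χ
with ε(½) = −1, onto which boundary, special AND exotic cycles project trivially — the
Blasius–Rogawski phenomenon (zbl:0828.14012) one degree up, with no Lefschetz (1,1) to save it.)
[AllcockCarlsonToledo2002, AllcockFreitag2002, ColomboVangeemen2004, GallardoKerrSchaffler2021,
zbl:0828.14012, KudlaMillson1990]
#3 TowerMiddleAlgebraic (crux) — (the thesis X; card Assembly sketch transported to the whole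
congruence tower) for every X in the sector (all congruence levels Γ(N) ⊆ Γ' ⊆ Aut(Λ), all smooth
projective birational models) every rational (2,2)-class in H⁴(X(ℂ);ℂ) lies in algebraicClasses X 2
— HC in BMM's excluded degree for the non-compact Eisenstein 4-ball tower; intended proof shape:
boundary-supported classes (abelian threefolds, known) + special cycles for the θ-part
(Kudla–Millson with toroidal corrections + archimedean matching for (U(4,1), U(2,2))) +
Hecke-saturated exotic moduli cycles for the rest. [deps: LevelThreeMiddleAlgebraic] [difficulty:
open-problem] (why it might fail: at deep level endoscopic cohomology grows (Marshall–Shin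
arXiv:1804.05047) while the exotic moduli supply is finite per level up to Hecke translation; one
Hecke piece of pure type (2,2) missed by every Hecke-translate of boundary/special/exotic classes
leaves HC open there with no candidate cycle.) [arXiv:1306.1515, KudlaMillson1990, arXiv:1804.05047,
Deraux2010, DolgachevGeemenKondo2005]
#4 LevelThreeCanonicalForms (crux) — (card 'Fastest refutation' turned into the honesty certificate;
refuter g2's 'first deliverable') every X as in LevelThreeMiddleAlgebraic carries a non-zero class
of Hodge type (4,0) in H⁴(X(ℂ);ℂ), i.e. p_g(X̄₃) = dim S₅(Γ(3)) > 0 (weight 5 = canonical weight on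
𝔹⁴; p_g is a birational invariant, so this is level-3 data only). Role: by the catalogued technique
barrier (DecompositionOfTheDiagonal: not_hasChowZeroSupportedInDimLE) it certifies that CH₀(X̄₃) is
NOT supported on a threefold, so LevelThreeMiddleAlgebraic is an honest instance of the middle third
and not a Bloch–Srinivas/Conte–Murre vacuity (as it is at level √−3, where Naruki's variety is
rational). Not an antecedent of the glue. [difficulty: M] (why it might fail: dim S₅(Γ(3)) may be 0
— level √−3 is rational (Naruki) and the (ℤ/3)^14-cover is branched only along the 36 nodal and 40
boundary divisors; then X̄₃ may even be uniruled and the census must climb to level 3√−3 or 9.)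
[Freitag2002, AllcockFreitag2002, zbl:1093.14033, BlochSrinivas1983, ConteMurre1978, Naruki1982]
#9 SectorFrame (support) — (SECTOR FRAME, machine-checked proof attached on
stmt-HodgeConjecture-16813: Sketch.lean `sectorFrame_of` and the prover-ready Theorems candidate
EisensteinMiddleThirdSectorFrame.lean, lean check rc 0; replaces, since the cone route-repair of
2026-08-16, the old glue SectorGlue stmt-14413 and the shared proved items LefschetzOneOne stmt-8544
/ HardLefschetzReduction stmt-1084, dropped from THIS route because their `_holds` links
auto-imported two Theorems files whose import closure carries 122 unproved named facts used by no
item) TowerMiddleAlgebraic → EisensteinTowerHodge: the Hodge-model conjunct of HodgeConjectureFor is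
the A of the sector hypothesis; case split on the codimension p — p = 0 by algebraicClasses_zero, p
= 1 by the tree's PROVED Lefschetz (1,1) (Theorems.lefschetzOneOne_proof, Voisin I Thm 11.30), p = 2
by TowerMiddleAlgebraic, p ≥ 3 by the tree's PROVED hard-Lefschetz reduction
(Theorems.linearSystemTorelli_hardLefschetzReduction_proof, Voisin I Thm 6.25) with n = 4 < 2p down
to codimension 4 − p ∈ {1, 0}. Not a hypothesis of `closes` (discharging it inside the proof would
re-import that cone); it closes the crux EisensteinTowerHodge and the Assembly item once
TowerMiddleAlgebraic is proved. Any idle prover: land Theorems/EisensteinMiddleThirdSectorFrame.lean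
(imports this Theses file + those two Theorems files; no back-import arises). [difficulty:
provable-now] [VoisinHodgeI2002, Deligne2000]
#9 SectorComplement (crux, auto-crux-badged conjecture-grade 2026-08-16; BOOKKEEPING, NOT CLAIMED —
the complement of the route's scope, exactly as SiuRepresentability.SectorComplement /
DerivedTorelliFermat.FourfoldSectorComplement) EisensteinTowerHodge → HodgeConjecture: the Hodge
conjecture off the Eisenstein Picard-modular sector. Implied by HodgeConjecture itself, irrefutable
short of ¬HC; second hypothesis of the crux-only `closes (hT : EisensteinTowerHodge) (hC :
SectorComplement) := hC hT` and of the Assembly item TowerMiddleAlgebraic → SectorComplement →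
HodgeConjecture. Refuters: skip; provers: nothing to do unless HC is otherwise settled. [difficulty:
open-problem] [Deligne2000]

TWO-LAYER PLAN. Foreseen glued splits (nothing filed now; k ≤ 3, depth 1). TowerMiddleAlgebraic ⇐
BoundarySupportedMiddleClasses (rational Hodge
classes in H⁴ supported on X ∖ U are algebraic: the tree's supported-class descent
SupportedHodgeClassDescent /
SupportedHodgeClassesAlgebraic + HC for threefolds and surfaces, known — provable modulo catalogued
facts) → InteriorMiddleClasses
(classes modulo boundary-supported ones = W₄H⁴(U) ≅ IH⁴ of the Baily–Borel model: the θ-part spanned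
by special cycles and
L·special divisors [Kudla–Millson for finite volume + A. Paul's archimedean theta for
(U(4,1),U(2,2)) + non-vanishing of the global
lift], the rest by Hecke-saturated exotic supply) → TowerMiddleAlgebraic. LevelThreeMiddleAlgebraic
⇐ LevelThreeSpecialExoticSpan
(informal rank-5 crux: the census) → SpanIsAlgebraic (definitional once special / exotic cycles are
typed over the requested
definitions) → LevelThreeMiddleAlgebraic; OR, if LevelThreeCanonicalForms is refuted and CH₀(X̄₃) is
supported on a threefold,
LevelThreeMiddleAlgebraic ⇐ HasChowZeroSupportedInDimLE X 3 → (Literature.Barriers.HodgeConjecture.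
BlochSrinivas1983_hodgeConjectureDegreeFour_of_chowZeroSupported, catalogued named fact) →
LevelThreeMiddleAlgebraic, and the census
re-targets the first level with p_g > 0 (new item LevelNineMiddleAlgebraic by workitem add, same
shape with 3 ↦ 9 or 3√−3).

KILL CRITERIA. (i) LevelThreeMiddleAlgebraic or TowerMiddleAlgebraic REFUTED is a non-algebraic
rational Hodge class, i.e. ¬HC: close
`refuted:<Decl>`, the summit is decided negatively and the witness goes to a negative route (cannot
happen cheaply: by the
Cattani–Deligne–Kaplan / absolute-Hodge barriers a refutation needs the arithmetic of the class —
which the K3 incarnation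
DolgachevGeemenKondo2005 makes accessible to DeltaPeriodAudit / PeriodsPolice-type audits). (ii) The
realistic kill:
LevelThreeSpecialExoticSpan refuted-SUBSTANTIVE by the census itself (certified rk Hdg⁴(X̄₃) > rk of
the boundary + NS·NS +
special + exotic span, certified because the deficient Hecke piece has h^{3,1} = h^{4,0} = 0): the
positive mechanism is dead at
level 3 — attach the deficit class (a named middle-third Hodge class with computable K3-type
periods) as evidence, hand it to
SiuRepresentability (obstruction branch of KaehlerRepresentable) and to the period-audit routes, and
close
`refuted:LevelThreeSpecialExoticSpan` unless a new cycle supply is named within the grace window.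
(iii) LevelThreeCanonicalForms
refuted (S₅(Γ(3)) = 0) is NOT a kill: `--drop` it (not load-bearing) and re-target the census one
level up; if moreover CH₀(X̄₃)
is supported on a threefold, LevelThreeMiddleAlgebraic closes PROVED via the catalogued
Bloch–Srinivas fact (vacuous level, as the
card's 'Fastest refutation' foresaw). (iv) Infeasibility: if h^{3,1} + h^{4,0} > 0 inside a Hecke
piece whose (2,2)-line cannot be
certified rational or irrational (a transcendence question), the census yields only bounds — route
dormant with the numbers as
evidence. (v) A theoretical proof of HC for Picard modular fourfolds (a non-compact middle-degree
BMM) moots the computation and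
PROVES the typed cruxes; full HC proved elsewhere moots the route.

NOT DECOMPOSED YET. The special-cycle and exotic-cycle vocabulary (definition requests below;
LevelThreeSpecialExoticSpan stays informal until they
land); the Hecke-isotypic bookkeeping for U(4,1)/ℚ(ω) (which Arthur parameters can carry rational
(2,2)-classes: θ-type Π₄⊞χ with
χ_∞ the middle character, endoscopic Π₃⊞Π₂ whose Hecke pieces mix (2,2) with (3,1),(1,3), stable —
an organising tool for the
census, not an item); toroidal corrections to Kudla–Millson intersection numbers at the cusps; the
K3-period incarnation of a deficit
class; levels strictly between √−3 and 3 and non-principal congruence subgroups (inside the sector,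
not singled out); NON-congruence
finite-index subgroups (they exist once b₁ > 0 at deep level — Kazhdan — and are outside the sector
by design: no Hecke operators);
the sibling Eisenstein balls (Kondō's 𝔹⁶ of plane quartics, ACT's 𝔹¹⁰ of cubic threefolds) and the
Gaussian lattices — sibling
sectors, not this route; the group-theoretic API (deck group = ⟨S⟩, torsion-freeness forced by the
covering condition, Borel
extension / uniqueness of the algebraic structure on Γ'\𝔹⁴, birational invariance of degree-4 HC
among smooth projective fourfolds
via Hironaka + the blow-up formula) — remarks for provers, no items.

CHEAPEST FALSIFIER. dim S₅(Γ(3)) — weight 5 = canonical weight on 𝔹⁴ — by the Hirzebruch–Mumford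
proportionality / Riemann–Roch dimension formula for
the neat group Γ(3) (covolume from ACT's orbifold Euler characteristic of Aut(Λ)\𝔹⁴ times the index
|O(5,3)|·3^14; for neat Γ(3)
only the cusp correction survives), equivalently χ(X̄₃, K) by Chevalley–Weil on the (ℤ/3)^14-cover
of Naruki's variety whose Chow
ring is known (ColomboVangeemen2004): a one-page computation / small kit job that decides
LevelThreeCanonicalForms; the same character
computation gives e(X̄₃) and (h^{4,0}, h^{3,1}, h^{2,2}), and comparing b₄ − 2h^{3,1} − 2h^{4,0}
with the count of boundary + NS² +
special classes tells at once whether level 3 can be vacuous or already shows a certified deficit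
(the cheapest decisive outcome of
the whole line). Lookup run this session (kills only novelty): no paper found computing Hodge
numbers or H⁴ of a congruence cover of the
Eisenstein 4-ball quotient (zbMATH 'Picard modular varieties cohomology': 20 hits, all Picard
SURFACES; the g2 refuter's leg found
CMGHL's Memoir 2023 / Nagoya 2024 at FULL level only).

NUMBERS. Λ = 𝓔^{1,4}, 𝓔 = ℤ[ω], form ā₀b₀ − ā₁b₁ − … − ā₄b₄ (AllcockFreitag2002 (2.1));
Aut(Λ)/Γ(√−3) ≅ O(5,3) ≅ W(E₆) × {±1}, order
103 680; Γ(√−3)-orbits: 40 cusps, 36 short-root (nodal) mirrors, 45 long-root (Eckardt) mirrors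
(AllcockFreitag2002 Prop. 2.1);
PΓ(√−3)/PΓ(3) elementary abelian of order 3^14 (first congruence layer at the ramified prime λ = √−3
is {A ∈ M₅(𝔽₃) : JA
symmetric} ≅ Sym₅(𝔽₃) of order 3^15, modulo the scalar ω ∈ Γ(√−3)); Γ(3) is torsion-free (λ-adic
valuation argument: (1 + 3A)^ℓ
= 1 forces A = 0) and neat (Γ(3) ⊂ GL₁₀(ℤ)(3)); canonical weight n + 1 = 5, so p_g(X̄_Γ') = dim
S₅(Γ'); BMM's excluded interval
for p = 4 is ]4/3, 8/3[ ∋ 2 only, so degrees 0, 2, 6, 8 are Lefschetz/hard-Lefschetz and degree 4 is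
the whole content;
(𝔤,K)-cohomology of U(4,1) with trivial coefficients: H^{2,2}_(2) = ℂ·L² ⊕ L·H^{1,1}[A(1,1)] ⊕
H[A(2,2)] (A(2,2) discrete series),
H^{3,1}_(2) = H[A(3,1)] ⊕ L·H[A(2,0)], H^{4,0}_(2) = H[A(4,0)]; the discrete-series L-packet of
U(4,1) at regular infinitesimal
character has 5 members ↔ Hodge types (4,0),…,(0,4), so a tempered endoscopic piece Π₃⊞Π₂ is never
of pure type (2,2) while a
θ-type piece Π₄⊞χ with χ_∞ in the middle position can be (granting the Arthur–Mok multiplicity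
formula; bookkeeping, not an item). Items after the cone route-repair (2026-08-16): 8 = 7 typed (5
crux-kinded — EisensteinTowerHodge [sector thesis, `closes` hypothesis], LevelThreeMiddleAlgebraic,
TowerMiddleAlgebraic, LevelThreeCanonicalForms [the three staffing cruxes], SectorComplement
[auto-crux residual] — plus the support SectorFrame and 1 assembly) + 1 informal crux
(LevelThreeSpecialExoticSpan, rank 5) ≤ 15.

DEFINITION REQUESTS. (1) `HodgeModel.IsBallCoveredOff (A : HodgeModel n X) (Z : Set X.left) (S : Set
(Matrix (Fin (n+1)) (Fin (n+1)) ℂ)) : Prop` (topic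
Literature/AlgebraicGeometry/HodgeTheory, next to CompactBallQuotient's `HodgeModel.IsBallCovered`):
the inline predicate of the
items — ∃ π : EuclideanSpace ℂ (Fin n) → A.carrier, holomorphic on the unit ball, restricting to a
surjective covering map of the
ball onto {x | (A.toComplexPoints x).pt ∉ Z}, with π z = π w ↔ ∃ γ ∈ S, w = γ·z (division-free
Möbius relation in the chart
z₀ = 1 for J = diag(1,−1,…,−1)); API wanted: independence of the Hodge model, ⟨S⟩ acts freely, and
`IsBallCovered A ↔
IsBallCoveredOff A ∅ S` for cocompact S. Items are to be restated verbatim over it when it lands.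
(2) `eisensteinUnitaryLevel (N :
ℕ) : Set (Matrix (Fin 5) (Fin 5) ℂ)` := {γ : entries in ℤ[ω], γᴴJγ = J, γ ≡ 1 mod N} (same topic or
Literature/NumberTheory/ArithmeticGroups), with torsion-freeness and neatness of level 3 as lemmas.
(3) `specialCycleSupport`: for a
positive-definite 𝓔-sublattice W ⊆ Λ of rank k, the Zariski closure in X of π(𝔹(W^⊥)) (an algebraic
(4−k)-fold by Chow +
Borel) as a `Set X.left`, so that `classesSupportedOn X (specialCycleSupport W) (2*k)` types the
special span — needed to type
LevelThreeSpecialExoticSpan's special part; the exotic part needs moduli of degree-2 del Pezzo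
surfaces (long-term). (4) Cite facts
wanted (family hodge): Borel's extension theorem and uniqueness of the quasi-projective structure on
Γ'\𝔹ⁿ (Borel1972 Thm 3.10);
smooth projective toroidal compactification with abelian boundary for neat ball lattices
(Ash–Mumford–Rapoport–Tai, Mok);
Kudla–Millson for finite-volume U(p,1) (KudlaMillson1990 with the Funke–Millson boundary analysis
FunkeMillson2006LocalCoefficients).

Novelty: Searches (2026-08-15, this session): `lit search --hybrid` local (15 generic book hits, none on the
mechanism); zbMATH: 'Picard
modular varieties cohomology' (20: all Picard modular SURFACES — Blasius–Rogawski zbl:0828.14012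
Tate classes on 2-ball
quotients and zbl:1135.11318 Hodge cycles on SU(2,1)^p quotients, Bergström–van der Geer
arXiv:2012.07673, Holzapfel zbl:1093.14033
dimension formulae, Goresky / Kottwitz–Rapoport in the Montreal volume; nothing in dimension 4),
'complex hyperbolic cubic surfaces
moduli ball quotient' (7: ACT ×2, Beauville's survey zbl:1195.14050, ACT cubic threefolds
arXiv:math/0608287, Dolgachev reflection
groups), 'Hodge conjecture ball quotients' (4: Baldi–Ullmo arXiv:2005.03524 — special subvarieties
of NON-arithmetic ball quotients,
Gallardo–Kerr–Schaffler arXiv:2006.01314), 'cubic surfaces Borcherds products' (4: Allcock–Freitag,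
Kondō ×2), and 0 hits for
'cohomology arithmetic subgroups U(4,1)', 'theta lifting cohomology Picard modular varieties',
'special cycles unitary groups
cohomology finite volume', 'Hodge conjecture arithmetic quotients unitary ball special cycles';
OpenAlex and Semantic Scholar legs
rate-limited (HTTP 429) all session — refuter please rerun 'cohomology congruence subgroup Picard
modular fourfold Eisenstein' there;
`lit galaxy search --star all`: 'moduli space of cubic surfaces' (29 rows: Allcock–Freitag CMH pdf
READ pp.1–4, Elsenhans–Jahnel
arXiv:1209.5591, GKS, Liu–Shen arXiv:1810.10892, Hunt's LNM 1637; nothing coho  [refs: 10.1007/s10231-003-0097-x:, 2012.07673, math/0608287, 2005.03524, 2006.01314, 1209.5591, 1810.10892, 1306.1515, doi:10.1007/s10231-003-0097-x, ColomboVangeemen2004, KudlaMillson1990, Deraux2010]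

Barriers (technique_class: census, special-cycles, moduli-cycles, hecke-spreading): - technique_class: census, special-cycles, moduli-cycles, hecke-spreading
- Literature.Barriers.HodgeConjecture.Weil1977_exceptionalHodgeClasses: evaded — the census
separates NS·NS from special and exotic classes and nothing assumes the Hodge ring is generated by
divisors; BMM Remark 3 (special cycles alone do not span even in codimension one) is built into the
span boundary + NS² + special + exotic.
- Literature.Barriers.HodgeConjecture.Mumford1968_simpleFourfold_exceptionalHodgeClasses: same
evasion; X̄₃ is a fourfold whose exceptional (2,2)-classes, if any, are exactly what the census
counts, with three non-divisorial supplies offered.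
- Literature.Barriers.HodgeConjecture.BlochSrinivas1983_hodgeTypeL0_vanish_of_chowZeroSupported:
this IS the barrier of the decomposition-of-the-diagonal technique (CH₀ supported in dimension ≤ 3
forces h^{4,0} = 0, so h^{4,0} ≠ 0 kills the Bloch–Srinivas/Conte–Murre method); the route uses it
only as the vacuous-level detector — LevelThreeCanonicalForms is precisely the statement that the
method does NOT apply at level 3, so the census is not a disguised Conte–Murre argument, and where
that crux fails the companion fact BlochSrinivas1983_hodgeConjectureDegreeFour_of_chowZeroSupported
(same file) closes LevelThreeMiddleAlgebraic honestly.
- Literature.Barriers.HodgeConjecture.CattaniDeligneKaplan1995_hodgeLocus_algebraicFor: refutation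
side only — a certified deficit is NOT claimed as a counterexample (Hodge loci being algebraic, no
cheap t

History (route lifecycle, newest last):
- 2026-08-16T16:43:24Z · AUTO-CRUX (backfill): SectorComplement — hypotheses of the deciding theorem that nothing in the route derives are cruxes (operator:999:1813213)
- 2026-08-16T21:12:05Z · rev 5: restated Assembly (stmt-HodgeConjecture-14415) — cone route-repair (3/4): restate Assembly to mirror the crux-only closes (it previously chained the shared proved supports LefschetzOneOne / HardLefschetzReduct (planner-rrepair-HodgeConjecture-EisensteinMidd-c3a5c43e-0)
- 2026-08-16T21:12:59Z · rev 6: restated Assembly (stmt-HodgeConjecture-16841) — cone route-repair (3b/4): the rev-5 Assembly (EisensteinTowerHodge → SectorComplement → HodgeConjecture) was ground.trivial (tauto) because SectorComplement unf (planner-rrepair-HodgeConjecture-EisensteinMidd-c3a5c43e-0)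
- 2026-08-16T21:13:27Z · rev 7: dropped LefschetzOneOne, HardLefschetzReduction, SectorGlue — cone route-repair (4/4): drop from THIS route the shared PROVED supports LefschetzOneOne (stmt-8544) and HardLefschetzReduction (stmt-1084) and the superseded g (planner-rrepair-HodgeConjecture-EisensteinMidd-c3a5c43e-0)
- 2026-08-17T04:08:17Z · rev 12: restated EisensteinTowerHodgeOfPieces (stmt-HodgeConjecture-17601) — render the glue item: EisensteinTowerHodgeOfPieces restated with X₁ = ConiveauOneMiddleFourfold spelled inline as the first hypothesis (stmt-17601 was rendered (planner-cstrat-stmt-HodgeConjecture-14409-r1-0)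
- 2026-08-24T22:01:04Z · DORMANT — reconciler: no traction for 7.1 d (last activity item-proof-filed at 2026-08-17T18:52:06Z); parked, not closed — `ledger route dormant route-HodgeConjecture-Eis (operator:999:2288793)

sub-problem: HodgeConjecture · status: dormant · opened planner-plancard-HodgeConjecture-HodgeConject-c3a7ddcb-g2-0 2026-08-15T19:08:13Z · rev 12 · ledger route-HodgeConjecture-EisensteinMiddleThird
GENERATED by the gate from the ledger (D-0016/17). Provers cite these decls: `theorem foo : Summit.HodgeConjecture.HodgeConjecture.Theses.EisensteinMiddleThird.<Decl> := …` in Summits/HodgeConjecture/HodgeConjecture/Theorems/<Name>.lean.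
-/

namespace Summit.HodgeConjecture.HodgeConjecture.Theses.EisensteinMiddleThird

open scoped BigOperators Topology Manifold Classical MeasureTheory ProbabilityTheory Matrix InnerProductSpace ComplexConjugate ContinuousMap
open Filter Set Function TopologicalSpace MeasureTheory

attribute [summit_statement] _root_.HodgeConjecture

/-- item stmt-HodgeConjecture-14409 · crux · rank 0 · open · by planner
why it might fail: HC in all degrees on every smooth model of every congruence cover of the Eisenstein 4-ball quotient: degree 4 is BMM's excluded middle ]4/3,8/3[ (arXiv:1306.1515, compact case only; these are non-compact); false iff some cover carries a non-algebraic rational (2,2)-class (cf. zbl:0828.14012).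
sources: arXiv:1306.1515, AllcockCarlsonToledo2002, BergeronMillsonMoeglin2016Balls, zbl:0828.14012, Deligne2000
[target] the Hodge conjecture (Literature HodgeConjectureFor 4 X, all codimensions) for every smooth
projective complex fourfold X with a Zariski-closed Z ⊆ X such that (X ∖ Z)^an is uniformised by 𝔹⁴
with deck relation generated by a set S of Λ-unitary Eisenstein-integral matrices containing the
principal congruence subgroup Γ(N) for some N ≥ 1 (typed inline: a Hodge model A, π : ℂ⁴ → A.carrier
holomorphic on the ball, a surjective covering map of the ball onto {x : (A.toComplexPoints x).pt ∉
Z}, and π z = π w ↔ ∃ γ ∈ S, w = γ·z division-free in the chart z₀ = 1). -/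
@[route_item "route-HodgeConjecture-EisensteinMiddleThird", crux]
def EisensteinTowerHodge : Prop :=
  ∀ ⦃X : Literature.AlgebraicGeometry.Motives.SchemeOver ℂ⦄, Literature.AlgebraicGeometry.Motives.IsSmoothProjective 4 X → (∃ (A : Literature.AlgebraicGeometry.HodgeTheory.HodgeModel 4 X) (Z : Set X.left) (S : Set (Matrix (Fin 5) (Fin 5) ℂ)) (N : ℕ) (π : EuclideanSpace ℂ (Fin 4) → A.carrier), IsClosed Z ∧ 0 < N ∧ (∀ γ ∈ S, (∀ i j, ∃ a b : ℤ, γ i j = (a : ℂ) + (b : ℂ) * ((-1 + Complex.I * (Real.sqrt 3 : ℂ)) / 2)) ∧ γᴴ * Matrix.diagonal ![(1 : ℂ), -1, -1, -1, -1] * γ = Matrix.diagonal ![(1 : ℂ), -1, -1, -1, -1]) ∧ (∀ γ : Matrix (Fin 5) (Fin 5) ℂ, (∀ i j, ∃ a b : ℤ, γ i j - (1 : Matrix (Fin 5) (Fin 5) ℂ) i j = (N : ℂ) * ((a : ℂ) + (b : ℂ) * ((-1 + Complex.I * (Real.sqrt 3 : ℂ)) / 2))) → γᴴ * Matrix.diagonal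 ![(1 : ℂ), -1, -1, -1, -1] * γ = Matrix.diagonal ![(1 : ℂ), -1, -1, -1, -1] → γ ∈ S) ∧ (∀ z ∈ Metric.ball (0 : EuclideanSpace ℂ (Fin 4)) 1, MDifferentiableAt 𝓘(ℂ, EuclideanSpace ℂ (Fin 4)) 𝓘(ℂ, A.model) π z) ∧ (∃ h : Set.MapsTo π (Metric.ball (0 : EuclideanSpace ℂ (Fin 4)) 1) {x : A.carrier | (A.toComplexPoints x).pt ∉ Z}, IsCoveringMap h.restrict ∧ Function.Surjective h.restrict) ∧ (∀ z ∈ Metric.ball (0 : EuclideanSpace ℂ (Fin 4)) 1, ∀ w ∈ Metric.ball (0 : EuclideanSpace ℂ (Fin 4)) 1, π z = π w ↔ ∃ γ ∈ S, ∀ i : Fin 4, EuclideanSpace.equiv (Fin 4) ℂ w i * (γ 0 0 + ∑ j : Fin 4, γ 0 (Fin.succ j) * EuclideanSpace.equiv (Fin 4) ℂ z j) = γ (Fin.succ i) 0 + ∑ j : Fin 4, γ (Fin.succ i) (Fin.succ j) * EuclideanSpace.equiv (Fin 4) ℂ z j)) → Literature.AlgebraicGeometry.HodgeTheory.HodgeConjectureFor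 4 X

/-- item stmt-HodgeConjecture-14410 · crux · rank 2 · open · by planner
why it might fail: A Hecke piece of H⁴(X̄₃) (IH⁴ ≈ 7.5·10⁶ at level 3) of θ-deficient type Π₄⊞χ (ε(½) = −1) or endoscopic type Π₃⊞Π₂ carrying a rational (2,2)-class onto which boundary, special AND exotic cycles project trivially: the Blasius–Rogawski deficit (zbl:0828.14012) one degree up, no Lefschetz (1,1) to help.
sources: arXiv:1306.1515, zbl:0828.14012, AllcockCarlsonToledo2002, AllcockFreitag2002, ColomboVangeemen2004, GallardoKerrSchaffler2021
[crux] (card verdict (iv), level Γ(3)) for every smooth projective fourfold X with Zariski-closed Z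
such that (X ∖ Z)^an ≅ Γ(3)\𝔹⁴, Γ(3) = {γ ∈ M₅(𝓔) : γᴴJγ = J, γ ≡ 1 mod 3} the (torsion-free, neat)
principal congruence subgroup of level 3 of Aut(𝓔^{1,4}) — e.g. the smooth toroidal compactification
X̄₃, an elementary-abelian 3-cover of Naruki's cross-ratio variety branched only along the 36 nodal
and 40 boundary divisors — every rational (2,2)-class in H⁴(X(ℂ);ℂ) lies in algebraicClasses X 2.
This is the census TARGET; its method is the informal crux LevelThreeSpecialExoticSpan (rank 5,
filed after open). [difficulty: XL] -/
@[route_item "route-HodgeConjecture-EisensteinMiddleThird"]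
def LevelThreeMiddleAlgebraic : Prop :=
  ∀ ⦃X : Literature.AlgebraicGeometry.Motives.SchemeOver ℂ⦄, Literature.AlgebraicGeometry.Motives.IsSmoothProjective 4 X → (∃ (A : Literature.AlgebraicGeometry.HodgeTheory.HodgeModel 4 X) (Z : Set X.left) (π : EuclideanSpace ℂ (Fin 4) → A.carrier), IsClosed Z ∧ (∀ z ∈ Metric.ball (0 : EuclideanSpace ℂ (Fin 4)) 1, MDifferentiableAt 𝓘(ℂ, EuclideanSpace ℂ (Fin 4)) 𝓘(ℂ, A.model) π z) ∧ (∃ h : Set.MapsTo π (Metric.ball (0 : EuclideanSpace ℂ (Fin 4)) 1) {x : A.carrier | (A.toComplexPoints x).pt ∉ Z}, IsCoveringMap h.restrict ∧ Function.Surjective h.restrict) ∧ (∀ z ∈ Metric.ball (0 : EuclideanSpace ℂ (Fin 4)) 1, ∀ w ∈ Metric.ball (0 : EuclideanSpace ℂ (Fin 4)) 1, π z = π w ↔ ∃ γ : Matrix (Fin 5) (Fin 5) ℂ, (∀ i j, ∃ a b : ℤ, γ i j - (1 : Matrix (Fin 5) (Fin 5) ℂ) i j = (3 : ℂ) * ((a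 : ℂ) + (b : ℂ) * ((-1 + Complex.I * (Real.sqrt 3 : ℂ)) / 2))) ∧ γᴴ * Matrix.diagonal ![(1 : ℂ), -1, -1, -1, -1] * γ = Matrix.diagonal ![(1 : ℂ), -1, -1, -1, -1] ∧ ∀ i : Fin 4, EuclideanSpace.equiv (Fin 4) ℂ w i * (γ 0 0 + ∑ j : Fin 4, γ 0 (Fin.succ j) * EuclideanSpace.equiv (Fin 4) ℂ z j) = γ (Fin.succ i) 0 + ∑ j : Fin 4, γ (Fin.succ i) (Fin.succ j) * EuclideanSpace.equiv (Fin 4) ℂ z j)) → ∀ c : Literature.AlgebraicGeometry.HodgeTheory.complexBetti X (2 * 2), Literature.AlgebraicGeometry.HodgeTheory.IsRationalClass c → Literature.AlgebraicGeometry.HodgeTheory.IsOfHodgeType 4 X (2 * 2) 2 2 c → c ∈ Literature.AlgebraicGeometry.HodgeTheory.algebraicClasses X 2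

/-- item stmt-HodgeConjecture-14411 · crux · rank 3 · open · by planner
why it might fail: h^{2,2} grows with the covolume up the tower (middle degree; endoscopic pieces at Marshall–Shin rates arXiv:1804.05047) but the exotic moduli supply is finite per level up to Hecke translation: a Hecke piece with a rational (2,2)-class missed by all boundary/special/exotic translates leaves HC open.
sources: arXiv:1306.1515, arXiv:1804.05047, KudlaMillson1990, Deraux2010, DolgachevGeemenKondo2005
[crux] (the thesis X; card Assembly sketch transported to the whole congruence tower) for every X in
the sector (all congruence levels Γ(N) ⊆ Γ' ⊆ Aut(Λ), all smooth projective birational models) every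
rational (2,2)-class in H⁴(X(ℂ);ℂ) lies in algebraicClasses X 2 — HC in BMM's excluded degree for
the non-compact Eisenstein 4-ball tower; intended proof shape: boundary-supported classes (abelian
threefolds, known) + special cycles for the θ-part (Kudla–Millson with toroidal corrections +
archimedean matching for (U(4,1), U(2,2))) + Hecke-saturated exotic moduli cycles for the rest.
[deps: LevelThreeMiddleAlgebraic] [difficulty: open-problem] -/
@[route_item "route-HodgeConjecture-EisensteinMiddleThird", crux]
def TowerMiddleAlgebraic : Prop :=
  ∀ ⦃X : Literature.AlgebraicGeometry.Motives.SchemeOver ℂ⦄, Literature.AlgebraicGeometry.Motives.IsSmoothProjective 4 X → (∃ (A : Literature.AlgebraicGeometry.HodgeTheory.HodgeModel 4 X) (Z : Set X.left) (S : Set (Matrix (Fin 5) (Fin 5) ℂ)) (N : ℕ) (π : EuclideanSpace ℂ (Fin 4) → A.carrier), IsClosed Z ∧ 0 < N ∧ (∀ γ ∈ S, (∀ i j, ∃ a b : ℤ, γ i j = (a : ℂ) + (b : ℂ) * ((-1 + Complex.I * (Real.sqrt 3 : ℂ)) / 2)) ∧ γᴴ * Matrix.diagonal ![(1 : ℂ),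 -1, -1, -1, -1] * γ = Matrix.diagonal ![(1 : ℂ), -1, -1, -1, -1]) ∧ (∀ γ : Matrix (Fin 5) (Fin 5) ℂ, (∀ i j, ∃ a b : ℤ, γ i j - (1 : Matrix (Fin 5) (Fin 5) ℂ) i j = (N : ℂ) * ((a : ℂ) + (b : ℂ) * ((-1 + Complex.I * (Real.sqrt 3 : ℂ)) / 2))) → γᴴ * Matrix.diagonal ![(1 : ℂ), -1, -1, -1, -1] * γ = Matrix.diagonal ![(1 : ℂ), -1, -1, -1, -1] → γ ∈ S) ∧ (∀ z ∈ Metric.ball (0 : EuclideanSpace ℂ (Fin 4)) 1, MDifferentiableAt 𝓘(ℂ, EuclideanSpace ℂ (Fin 4)) 𝓘(ℂ, A.model) π z) ∧ (∃ h : Set.MapsTo π (Metric.ball (0 : EuclideanSpace ℂ (Fin 4)) 1) {x : A.carrier | (A.toComplexPoints x).pt ∉ Z}, IsCoveringMap h.restrict ∧ Function.Surjective h.restrict) ∧ (∀ z ∈ Metric.ball (0 : EuclideanSpace ℂ (Fin 4)) 1, ∀ w ∈ Metric.ball (0 : EuclideanSpace ℂ (Fin 4)) 1, π z = π w ↔ ∃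 γ ∈ S, ∀ i : Fin 4, EuclideanSpace.equiv (Fin 4) ℂ w i * (γ 0 0 + ∑ j : Fin 4, γ 0 (Fin.succ j) * EuclideanSpace.equiv (Fin 4) ℂ z j) = γ (Fin.succ i) 0 + ∑ j : Fin 4, γ (Fin.succ i) (Fin.succ j) * EuclideanSpace.equiv (Fin 4) ℂ z j)) → ∀ c : Literature.AlgebraicGeometry.HodgeTheory.complexBetti X (2 * 2), Literature.AlgebraicGeometry.HodgeTheory.IsRationalClass c → Literature.AlgebraicGeometry.HodgeTheory.IsOfHodgeType 4 X (2 * 2) 2 2 c → c ∈ Literature.AlgebraicGeometry.HodgeTheory.algebraicClasses X 2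

/-- item stmt-HodgeConjecture-19001 · crux · rank 3 · open · by planner
why it might fail: An L² Hecke piece of H⁴_!(Γ'\𝔹⁴) of θ-deficient type Π₄⊞χ (ε(½) = −1) or endoscopic type carrying a rational (2,2)-line missed by every special AND exotic cycle: the Blasius–Rogawski deficit one degree up, inside BMM's excluded middle third (open even for compact quotients).
sources: BergeronMillsonMoeglin2016Balls, arXiv:1306.1515, Zucker1979, KudlaMillson1990, FunkeMillson2002, BlasiusRogawski2000
[crux] (piece X₂ of the strategist's BC2-redirect split of EisensteinTowerHodge, 2026-08-17 — the
CUSPIDAL / L² piece) For X in the Eisenstein Picard-modular sector (the route's inline datum A, Z, S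
⊇ Γ(N), π: (X ∖ Z)^an ≅ Γ'\𝔹⁴, curried so that Z is in scope) and every rational (2,2)-class c which
dies on every smooth projective threefold mapping into the boundary Z (by Deligne's weights: c comes
from H⁴_c(U), i.e. c|_U lies in the interior cohomology H⁴_!(Γ'\𝔹⁴) = IH⁴(Baily–Borel) = H⁴_(2) = ⊕
m(π) H⁴(𝔤,K;π_∞) — Zucker 1979 / Looijenga, Saper–Stern, Borel–Casselman), c differs from a RATIONAL
algebraic class a by a class supported on Z: restrictCompl X Z 4 (c − a) = 0. = the Hodge conjecture
for the L²-cohomology of the open Picard-modular fourfold in BMM's excluded degree 4, the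
automorphic heart of the route: θ-type packets by Kudla–Millson / Funke–Millson special cycles in
finite volume, the rest by Hecke-saturated exotic moduli cycles (ACT cubic-surface moduli). Strictly
weaker than TowerMiddleAlgebraic and than EisensteinTowerHodge (take a := c); not conversely without
TowerEisensteinMiddle + ConiveauOneMiddleFourfold (glue EisensteinTowerHodgeOfPieces, proved). Cheap
probes -/
@[route_item "route-HodgeConjecture-EisensteinMiddleThird", crux]
def TowerCuspidalMiddle : Prop :=
  ∀ ⦃X : Literature.AlgebraicGeometry.Motives.SchemeOver ℂ⦄, Literature.AlgebraicGeometry.Motives.IsSmoothProjective 4 X → ∀ (A : Literature.AlgebraicGeometry.HodgeTheory.HodgeModel 4 X) (Z : Set X.left) (S : Set (Matrix (Fin 5) (Fin 5) ℂ)) (N : ℕ) (π : EuclideanSpace ℂ (Fin 4) → A.carrier), IsClosed Z ∧ 0 < N ∧ (∀ γ ∈ S, (∀ i j, ∃ a b : ℤ, γ i j = (a : ℂ) + (b : ℂ) * ((-1 + Complex.I * (Real.sqrt 3 : ℂ)) / 2)) ∧ γᴴ * Matrix.diagonal ![(1 : ℂ), -1, -1, -1, -1] * γ = Matrix.diagonal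 ![(1 : ℂ), -1, -1, -1, -1]) ∧ (∀ γ : Matrix (Fin 5) (Fin 5) ℂ, (∀ i j, ∃ a b : ℤ, γ i j - (1 : Matrix (Fin 5) (Fin 5) ℂ) i j = (N : ℂ) * ((a : ℂ) + (b : ℂ) * ((-1 + Complex.I * (Real.sqrt 3 : ℂ)) / 2))) → γᴴ * Matrix.diagonal ![(1 : ℂ), -1, -1, -1, -1] * γ = Matrix.diagonal ![(1 : ℂ), -1, -1, -1, -1] → γ ∈ S) ∧ (∀ z ∈ Metric.ball (0 : EuclideanSpace ℂ (Fin 4)) 1, MDifferentiableAt 𝓘(ℂ, EuclideanSpace ℂ (Fin 4)) 𝓘(ℂ, A.model) π z) ∧ (∃ h : Set.MapsTo π (Metric.ball (0 : EuclideanSpace ℂ (Fin 4)) 1) {x : A.carrier | (A.toComplexPoints x).pt ∉ Z}, IsCoveringMap h.restrict ∧ Function.Surjective h.restrict) ∧ (∀ z ∈ Metric.ball (0 : EuclideanSpace ℂ (Fin 4)) 1, ∀ w ∈ Metric.ball (0 : EuclideanSpace ℂ (Fin 4)) 1, π z = π w ↔ ∃ γ ∈ S, ∀ i : Fin 4, EuclideanSpace.equiv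 (Fin 4) ℂ w i * (γ 0 0 + ∑ j : Fin 4, γ 0 (Fin.succ j) * EuclideanSpace.equiv (Fin 4) ℂ z j) = γ (Fin.succ i) 0 + ∑ j : Fin 4, γ (Fin.succ i) (Fin.succ j) * EuclideanSpace.equiv (Fin 4) ℂ z j) → ∀ c : Literature.AlgebraicGeometry.HodgeTheory.complexBetti X (2 * 2), Literature.AlgebraicGeometry.HodgeTheory.IsRationalClass c → Literature.AlgebraicGeometry.HodgeTheory.IsOfHodgeType 4 X (2 * 2) 2 2 c → (∀ (Y : Literature.AlgebraicGeometry.Motives.SchemeOver ℂ) (g : Y ⟶ X), Literature.AlgebraicGeometry.Motives.IsSmoothProjective 3 Y → Set.range g.left.base ⊆ Z → Literature.AlgebraicTopology.SingularHomology.singularCohomology.map ℂ ℂ (Literature.AlgebraicGeometry.Motives.AlgPoints.mapContinuous (L := ℂ) g) (2 * 2) c = 0) → ∃ a ∈ Literature.AlgebraicGeometry.HodgeTheory.algebraicClasses X 2, Literature.AlgebraicGeometry.HodgeTheory.IsRationalClass a ∧ Literature.AlgebraicGeometry.HodgeTheory.complexBetti.restrictCompl X Z (2 * 2) (c - a) =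 0

/-- item stmt-HodgeConjecture-14412 · crux · rank 4 · open · by planner
why it might fail: Refuter's exact χ(O_X̄₃) = 3^13 + 3^9 (Colombo–van Geemen Chow ring + Allcock–Freitag) gives p_g = 1614005 + h^{1,0} + h^{3,0} − h^{2,0}: fails only if non-tempered (2,0)-pieces at level 3 reach multiplicity ≈ 1.6·10⁶ (vs Marshall–Shin sub-volume growth) or that log-RR + cusp computation is wrong.
sources: ColomboVangeemen2004, AllcockFreitag2002, Freitag2002, zbl:1093.14033, arXiv:1804.05047, arXiv:2008.13106
[crux] (card 'Fastest refutation' turned into the honesty certificate; refuter g2's 'first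
deliverable') every X as in LevelThreeMiddleAlgebraic carries a non-zero class of Hodge type (4,0)
in H⁴(X(ℂ);ℂ), i.e. p_g(X̄₃) = dim S₅(Γ(3)) > 0 (weight 5 = canonical weight on 𝔹⁴; p_g is a
birational invariant, so this is level-3 data only). Role: by the catalogued technique barrier
(DecompositionOfTheDiagonal: not_hasChowZeroSupportedInDimLE) it certifies that CH₀(X̄₃) is NOT
supported on a threefold, so LevelThreeMiddleAlgebraic is an honest instance of the middle third and
not a Bloch–Srinivas/Conte–Murre vacuity (as it is at level √−3, where Naruki's variety is
rational). Not an antecedent of the glue. [difficulty: M] -/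
@[route_item "route-HodgeConjecture-EisensteinMiddleThird"]
def LevelThreeCanonicalForms : Prop :=
  ∀ ⦃X : Literature.AlgebraicGeometry.Motives.SchemeOver ℂ⦄, Literature.AlgebraicGeometry.Motives.IsSmoothProjective 4 X → (∃ (A : Literature.AlgebraicGeometry.HodgeTheory.HodgeModel 4 X) (Z : Set X.left) (π : EuclideanSpace ℂ (Fin 4) → A.carrier), IsClosed Z ∧ (∀ z ∈ Metric.ball (0 : EuclideanSpace ℂ (Fin 4)) 1, MDifferentiableAt 𝓘(ℂ, EuclideanSpace ℂ (Fin 4)) 𝓘(ℂ, A.model) π z) ∧ (∃ h : Set.MapsTo π (Metric.ball (0 : EuclideanSpace ℂ (Fin 4)) 1) {x : A.carrier | (A.toComplexPoints x).pt ∉ Z}, IsCoveringMap h.restrict ∧ Function.Surjective h.restrict) ∧ (∀ z ∈ Metric.ball (0 : EuclideanSpace ℂ (Fin 4)) 1, ∀ w ∈ Metric.ball (0 : EuclideanSpace ℂ (Fin 4)) 1, π z = π w ↔ ∃ γ : Matrix (Fin 5) (Fin 5) ℂ, (∀ i j, ∃ a b : ℤ, γ i j - (1 : Matrix (Fin 5)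 (Fin 5) ℂ) i j = (3 : ℂ) * ((a : ℂ) + (b : ℂ) * ((-1 + Complex.I * (Real.sqrt 3 : ℂ)) / 2))) ∧ γᴴ * Matrix.diagonal ![(1 : ℂ), -1, -1, -1, -1] * γ = Matrix.diagonal ![(1 : ℂ), -1, -1, -1, -1] ∧ ∀ i : Fin 4, EuclideanSpace.equiv (Fin 4) ℂ w i * (γ 0 0 + ∑ j : Fin 4, γ 0 (Fin.succ j) * EuclideanSpace.equiv (Fin 4) ℂ z j) = γ (Fin.succ i) 0 + ∑ j : Fin 4, γ (Fin.succ i) (Fin.succ j) * EuclideanSpace.equiv (Fin 4) ℂ z j)) → ∃ c : Literature.AlgebraicGeometry.HodgeTheory.complexBetti X 4, c ≠ 0 ∧ Literature.AlgebraicGeometry.HodgeTheory.IsOfHodgeType 4 X 4 4 0 c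

/-- item stmt-HodgeConjecture-19002 · crux · rank 5 · open · by planner
why it might fail: The restriction image of Hdg⁴(X̄) in ⊕H⁴(Bᵢ) (Bᵢ ~ E_ω³, curve lattice of rank 9 per cusp) may exceed the span of restrictions of boundary-divisor products, special divisors and special surfaces through the cusps: an Eisenstein (2,2)-class of Γ' with no cycle behind it.
sources: Harder1987, Harder1993, Schwermer1994, FunkeMillson2002, GoreskyMacpherson1980, AllcockCarlsonToledo2002
[crux] (piece X₃ of the strategist's BC2-redirect split of EisensteinTowerHodge, 2026-08-17 — the
EISENSTEIN / boundary-restriction piece) For X in the Eisenstein Picard-modular sector (inline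
datum, curried so that Z is in scope) and every rational (2,2)-class c there is ONE rational
algebraic class a with g^*(c − a) = 0 for every g : Y ⟶ X from a smooth projective threefold whose
image lies in the boundary Z (resolutions of the 3-dimensional boundary components;
lower-dimensional components padded by ℙʳ). Equivalently: the image of Hdg⁴(X)_ℚ in ⊕ᵢ H⁴(Ỹᵢ) is
covered by the image of the rational algebraic classes — for the toroidal model X̄_Γ' with Z = ⊔ Bᵢ
(CM abelian threefolds isogenous to E_ω³ over the cusps) a finite linear-algebra statement per
level: restrictions of boundary-divisor products Bᵢ·D, special (Heegner) divisors squared and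
special Picard-modular surfaces through the cusps must span the restriction image (rank ≤ 9 ·
#cusps). This is the Eisenstein-cohomology side of H⁴(Γ') (Harder; Schwermer) and the boundary
behaviour of Kudla–Millson classes (Funke–Millson); computable at level 3 from the 40 cusps of
Allcock–Freitag. Implied by EisensteinTowerHodge (a := c); do -/
@[route_item "route-HodgeConjecture-EisensteinMiddleThird", crux]
def TowerEisensteinMiddle : Prop :=
  ∀ ⦃X : Literature.AlgebraicGeometry.Motives.SchemeOver ℂ⦄, Literature.AlgebraicGeometry.Motives.IsSmoothProjective 4 X → ∀ (A : Literature.AlgebraicGeometry.HodgeTheory.HodgeModel 4 X) (Z : Set X.left) (S : Set (Matrix (Fin 5) (Fin 5) ℂ)) (N : ℕ) (π : EuclideanSpace ℂ (Fin 4) → A.carrier), IsClosed Z ∧ 0 < N ∧ (∀ γ ∈ S, (∀ i j, ∃ a b : ℤ, γ i j = (a : ℂ) + (b : ℂ) * ((-1 + Complex.I * (Real.sqrt 3 : ℂ)) / 2)) ∧ γᴴ * Matrix.diagonal ![(1 : ℂ), -1, -1, -1, -1] * γ = Matrix.diagonal ![(1 : ℂ), -1, -1, -1, -1]) ∧ (∀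 γ : Matrix (Fin 5) (Fin 5) ℂ, (∀ i j, ∃ a b : ℤ, γ i j - (1 : Matrix (Fin 5) (Fin 5) ℂ) i j = (N : ℂ) * ((a : ℂ) + (b : ℂ) * ((-1 + Complex.I * (Real.sqrt 3 : ℂ)) / 2))) → γᴴ * Matrix.diagonal ![(1 : ℂ), -1, -1, -1, -1] * γ = Matrix.diagonal ![(1 : ℂ), -1, -1, -1, -1] → γ ∈ S) ∧ (∀ z ∈ Metric.ball (0 : EuclideanSpace ℂ (Fin 4)) 1, MDifferentiableAt 𝓘(ℂ, EuclideanSpace ℂ (Fin 4)) 𝓘(ℂ, A.model) π z) ∧ (∃ h : Set.MapsTo π (Metric.ball (0 : EuclideanSpace ℂ (Fin 4)) 1) {x : A.carrier | (A.toComplexPoints x).pt ∉ Z}, IsCoveringMap h.restrict ∧ Function.Surjective h.restrict) ∧ (∀ z ∈ Metric.ball (0 : EuclideanSpace ℂ (Fin 4)) 1, ∀ w ∈ Metric.ball (0 : EuclideanSpace ℂ (Fin 4)) 1, π z = π w ↔ ∃ γ ∈ S, ∀ i : Fin 4, EuclideanSpace.equiv (Fin 4) ℂ w i * (γ 0 0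 + ∑ j : Fin 4, γ 0 (Fin.succ j) * EuclideanSpace.equiv (Fin 4) ℂ z j) = γ (Fin.succ i) 0 + ∑ j : Fin 4, γ (Fin.succ i) (Fin.succ j) * EuclideanSpace.equiv (Fin 4) ℂ z j) → ∀ c : Literature.AlgebraicGeometry.HodgeTheory.complexBetti X (2 * 2), Literature.AlgebraicGeometry.HodgeTheory.IsRationalClass c → Literature.AlgebraicGeometry.HodgeTheory.IsOfHodgeType 4 X (2 * 2) 2 2 c → ∃ a ∈ Literature.AlgebraicGeometry.HodgeTheory.algebraicClasses X 2, Literature.AlgebraicGeometry.HodgeTheory.IsRationalClass a ∧ ∀ (Y : Literature.AlgebraicGeometry.Motives.SchemeOver ℂ) (g : Y ⟶ X), Literature.AlgebraicGeometry.Motives.IsSmoothProjective 3 Y → Set.range g.left.base ⊆ Z → Literature.AlgebraicTopology.SingularHomology.singularCohomology.map ℂ ℂ (Literature.AlgebraicGeometry.Motives.AlgPoints.mapContinuous (L := ℂ) g) (2 * 2) (c - a) = 0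

/-- item stmt-HodgeConjecture-14414 · crux (kind.auto-crux: conjecture-grade) · rank 9 · open · by planner
why it might fail: auto-crux — summit-strength (notes:refuter-refute-pool-g44-27): the deciding theorem assumes it and nothing in the route derives it, so it is a bet, not glue
sources: Deligne2000
[support] (BOOKKEEPING, NOT CLAIMED — the complement of the route's scope, exactly as
SiuRepresentability.SectorComplement / DerivedTorelliFermat.FourfoldSectorComplement)
EisensteinTowerHodge → HodgeConjecture: the Hodge conjecture off the Eisenstein Picard-modular
sector. Implied by HodgeConjecture itself, irrefutable short of ¬HC; filed only so that the D-0019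
frame crux → … → summit is explicit with hypotheses exactly the items. Refuters: skip; provers:
nothing to do unless HC is otherwise settled. [difficulty: open-problem] -/
@[route_item "route-HodgeConjecture-EisensteinMiddleThird", crux]
def SectorComplement : Prop :=
  EisensteinTowerHodge → HodgeConjecture

-- item stmt-HodgeConjecture-13447 · support · rank 5 · open · by planner — informal only, no Lean statement yet:
--   [crux] (rank 5; card K1+K2+K3 = the census METHOD; INFORMAL until `specialCycleSupport` /
--   `HodgeModel.IsBallCoveredOff` land — decl name LevelThreeSpecialExoticSpan reserved.) Statement: let
--   X̄₃ be the smooth toroidal compactification of Γ(3)\𝔹⁴, Γ(3) = {γ ∈ M₅(ℤ[ω]) : γᴴJγ = J, γ ≡ 1 mod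
--   3} ⊂ Aut(Λ), Λ = 𝓔^{1,4}, J = diag(1,−1,−1,−1,−1) (Allcock–Freitag (2.1); Γ(3) is torsion-free and
--   neat, X̄₃ → Naruki's cross-ratio variety is a (ℤ/3)^14-cover branched to order 3 only along the 36
--   nodal and 40 boundary divisors). Then Hdg⁴(X̄₃, ℚ) ⊗ ℂ EQUALS the ℂ-span of (a) the classes
--   supported on the bou

/-- item stmt-HodgeConjecture-16813 · support · rank 9 · closed · proved by Summit.HodgeConjecture.HodgeConjecture.Theorems.eisensteinMiddleThird_sectorFrame_proof @ a56a0d274c4b (prover) · by planner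
[support] (SECTOR FRAME, provable NOW — cone route-repair 2026-08-16; replaces SectorGlue + the
shared proved items LefschetzOneOne stmt-8544 / HardLefschetzReduction stmt-1084 in THIS route,
whose `_holds` links auto-imported two Theorems files carrying ≈1 150 Literature modules and 122
unproved named facts into the route's import cone, none used by any item) the degree-4 crux alone
carries the sector to the target: TowerMiddleAlgebraic → EisensteinTowerHodge. PROOF
(machine-checked, repair planner's Sketch.lean `sectorFrame_of` / `sectorFrame_holds`, lean check rc
0, 0 sorries): the Hodge-model conjunct of HodgeConjectureFor is the A of the sector hypothesis;
then case split on the codimension p — p = 0 by algebraicClasses_zero, p = 1 by the tree's PROVED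
Lefschetz (1,1) `Summit.HodgeConjecture.HodgeConjecture.Theorems.lefschetzOneOne_proof`
(Theorems/CurveNetMordellWeilLefschetzOneOneClose), p = 2 by TowerMiddleAlgebraic, p ≥ 3 by the
tree's PROVED hard-Lefschetz reduction `…Theorems.linearSystemTorelli_hardLefschetzReduction_proof`
(Theorems/LinearSystemTorelliHardLefschetzReduction) with n = 4 < 2p, down to codimension 4 − p ∈
{1, 0} (Lefschetz (1,1) resp. algebraicClasses_zer -/
@[route_item "route-HodgeConjecture-EisensteinMiddleThird"]
def SectorFrame : Prop :=
  TowerMiddleAlgebraic → EisensteinTowerHodge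

-- earlier EisensteinTowerHodgeOfPieces (stmt-HodgeConjecture-17601, replaced 2026-08-17T04:08:17Z -> stmt-HodgeConjecture-17631): retired by None — ConiveauOneMiddleFourfold → TowerCuspidalMiddle → TowerEisensteinMiddle → EisensteinTowerHodge
/-- item stmt-HodgeConjecture-17631 · support · rank 9 · closed · proved by Summit.HodgeConjecture.HodgeConjecture.Theorems.eisensteinTowerHodgeOfPieces_proof @ dcf9a1c541d3 (prover) · by planner
sources: DeligneHodgeIII1974, VoisinHodgeI2002, BergeronMillsonMoeglin2016Balls
[support] GLUE of the strategist's BC2-redirect split (2026-08-17): X₁ ∧ X₂ ∧ X₃ →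
EisensteinTowerHodge, with X₁ = ConiveauOneMiddleFourfold (stmt-18997) spelled INLINE as the first
hypothesis (verbatim its statement — the renderer sorts this support item before
ConiveauOneMiddleFourfold, so the name would be a forward reference), X₂ = TowerCuspidalMiddle, X₃ =
TowerEisensteinMiddle. PROVED sorry-free — `eisensteinTowerHodgeOfPieces_proof` in the strategist's
SplitAssembly.lean (lean check rc 0, 0 sorries, axioms propext/Classical.choice/Quot.sound, ≈40
tactic lines; attached as evidence on this item and on stmt-HodgeConjecture-14409, published as
Cruxes/EisensteinTowerHodge/Lines/split-assembly.lean), landable VERBATIM by any prover as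
Theorems/EisensteinMiddleThirdEisensteinTowerHodgeOfPieces.lean (Theorems/ is prover-only). NOT a
logic seam: Hodge-model conjunct := the A of the sector datum; degrees 2p ≠ 4 by the tree's PROVED
Lefschetz (1,1) `lefschetzOneOne_rational_holds` + hard Lefschetz
`nonempty_hardLefschetzNFold_holds` via `mem_algebraicClasses_of_lefschetzRange`; degree 4: the
boundary Z is a PROPER Zariski-closed subset (the ball covers the non-empty off-locus), hence -/
@[route_item "route-HodgeConjecture-EisensteinMiddleThird"]
def EisensteinTowerHodgeOfPieces : Prop :=
  (∀ ⦃X : Literature.AlgebraicGeometry.Motives.SchemeOver ℂ⦄, Literature.AlgebraicGeometry.Motives.IsSmoothProjective 4 X → ∀ c : Literature.AlgebraicGeometry.HodgeTheory.complexBetti X (2 * 2), Literature.AlgebraicGeometry.HodgeTheory.IsRationalClass c → Literature.AlgebraicGeometry.HodgeTheory.IsOfHodgeType 4 X (2 * 2) 2 2 c → c ∈ Literature.AlgebraicGeometry.HodgeTheory.supportedClasses X (2 * 2) 1 → c ∈ Literature.AlgebraicGeometry.HodgeTheory.algebraicClasses X 2) → TowerCuspidalMiddle → TowerEisensteinMiddle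 → EisensteinTowerHodge

/-- item stmt-HodgeConjecture-18997 · support · rank 9 · closed · proved by Summit.HodgeConjecture.HodgeConjecture.Theorems.eisensteinMiddleThird_coniveauOneMiddleFourfold_proof @ 98f953140101 (prover) · by planner
[support] (piece X₁ of the strategist's BC2-redirect split of EisensteinTowerHodge, 2026-08-17;
KNOWN-GRADE) On every smooth projective complex FOURFOLD a rational (2,2)-class of coniveau ≥ 1
(supported on a proper Zariski-closed subset: c ∈ supportedClasses X 4 1) is algebraic. = the tree's
DivisorInduction at (n,p) = (3,2) composed with the PROVED Lefschetz (1,1):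
`divisorInduction_of_deligne_of_hodgeClassLift hA hB 3 2 _ lefschetzOneOne_rational_holds`, hA =
Deligne1974_ker_restrictCompl_eq_iSup_range_complexGysin (Hodge III Cor. 8.2.8), hB =
Voisin2025_hodgeClass_lift_complexGysin (semisimple Gysin lift, Voisin 2025 Cor. 2.12) — catalogued,
undischarged XL facts shared by the hodge family; checked 2-stub skeleton in
Cruxes/EisensteinTowerHodge/Lines/. Role: absorbs the remainder c − a₁ − a₂ of the glue
EisensteinTowerHodgeOfPieces, which is supported on the boundary Z (codimension ≥ 1). Why it might
fail: only if hA/hB are mis-typed for reducible non-equidimensional supports (the ×ℙʳ padding of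
BFNP Lemma 48 is already inside DivisorInduction). Sources: DeligneHodgeIII1974 Cor. 8.2.8;
Voisin2025 Cor. 2.12; VoisinHodgeI2002 Thm. 11.30; Thomas2005Nodes §2; Jannsen1990MixedMotives -/
@[route_item "route-HodgeConjecture-EisensteinMiddleThird", crux]
def ConiveauOneMiddleFourfold : Prop :=
  ∀ ⦃X : Literature.AlgebraicGeometry.Motives.SchemeOver ℂ⦄, Literature.AlgebraicGeometry.Motives.IsSmoothProjective 4 X → ∀ c : Literature.AlgebraicGeometry.HodgeTheory.complexBetti X (2 * 2), Literature.AlgebraicGeometry.HodgeTheory.IsRationalClass c → Literature.AlgebraicGeometry.HodgeTheory.IsOfHodgeType 4 X (2 * 2) 2 2 c → c ∈ Literature.AlgebraicGeometry.HodgeTheory.supportedClasses X (2 * 2) 1 → c ∈ Literature.AlgebraicGeometry.HodgeTheory.algebraicClasses X 2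

-- earlier Assembly (stmt-HodgeConjecture-14415, replaced 2026-08-16T21:12:05Z -> stmt-HodgeConjecture-16841): retired by None — TowerMiddleAlgebraic → LefschetzOneOne → HardLefschetzReduction → SectorGlue → SectorComplement → HodgeConjecture
-- earlier Assembly (stmt-HodgeConjecture-16841, replaced 2026-08-16T21:12:59Z -> stmt-HodgeConjecture-16851): retired by None — EisensteinTowerHodge → SectorComplement → HodgeConjecture
/-- item stmt-HodgeConjecture-16851 · assembly · rank 1 · closed · proved by Summit.HodgeConjecture.HodgeConjecture.Theorems.eisensteinMiddleThird_assembly_proof @ b49caa3f4772 (prover) · by planner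
sources: Deligne2000, VoisinHodgeI2002
[assembly] TowerMiddleAlgebraic → SectorComplement → HodgeConjecture — the D-0019 frame '#1 X →
Statement' for the thesis X = TowerMiddleAlgebraic (degree 4 on the Eisenstein Picard-modular
sector) composed with the declared sector residual SectorComplement. NOT a tautology: it carries the
route's genuine glue mathematics (Lefschetz (1,1) for degree 2, hard-Lefschetz reduction for degrees
6 and 8, both PROVED in the tree) and is provable now as `fun hM hC ↦ hC (sectorFrame_proof hM)`
from the support SectorFrame stmt-HodgeConjecture-16813 (machine-checked proof attached there:
Sketch.lean / EisensteinMiddleThirdSectorFrame.lean, lean check rc 0). The crux-only deciding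
theorem is `closes (hT : EisensteinTowerHodge) (hC : SectorComplement) := hC hT` (cone route-repair
2026-08-16). -/
@[route_item "route-HodgeConjecture-EisensteinMiddleThird"]
def Assembly : Prop :=
  TowerMiddleAlgebraic → SectorComplement → HodgeConjecture

-- records of items no longer active in this route (dropped / restated):
-- earlier HardLefschetzReduction (stmt-HodgeConjecture-1084, dropped 2026-08-16T21:13:27Z): proved by Summit.HodgeConjecture.HodgeConjecture.Theorems.linearSystemTorelli_hardLefschetzReduction_proof @ fc8b66396040 — ∀ (n p : ℕ), n < 2 * p → ∀ ⦃X : Literature.AlgebraicGeometry.Motives.SchemeOver ℂ⦄, Literature.AlgebraicGeometry.Motives.IsSmoothProjective n X → (∀ c : Literature.AlgebraicGeometry.Hodg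
-- earlier LefschetzOneOne (stmt-HodgeConjecture-8544, dropped 2026-08-16T21:13:27Z): proved by Summit.HodgeConjecture.HodgeConjecture.Theorems.lefschetzOneOne_proof @ 44a5d6d9a7d8 — ∀ ⦃n : ℕ⦄ ⦃X : Literature.AlgebraicGeometry.Motives.SchemeOver ℂ⦄, Literature.AlgebraicGeometry.Motives.IsSmoothProjective n X → ∀ c : Literature.AlgebraicGeometry.HodgeTheory.complexBetti X (2 * 1), Literature.Algebraic

/-! D-0027 §2.1 — DECIDING THEOREM (planner-authored via `route open/edit --closes-file`; by planner-rrepair-HodgeConjecture-EisensteinMidd-c3a5c43e-0 2026-08-16T21:11:36Z):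
its hypotheses are this route's items and its conclusion the sub-problem Statement (glue_lint), and it elaborates with this file. -/

@[closes "route-HodgeConjecture-EisensteinMiddleThird"] theorem closes (hT : EisensteinTowerHodge) (hC : SectorComplement) : HodgeConjecture :=
  hC hT

end Summit.HodgeConjecture.HodgeConjecture.Theses.EisensteinMiddleThird
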